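import Summits.ResolutionOfSingularities.ResolutionOfSingularities.Theorems.WeightedInvariantIota3SigmaLevelLimitFormal
import Summits.ResolutionOfSingularities.ResolutionOfSingularities.Theorems.WeightedInvariantTieFiniteChartPrelims
import Summits.ResolutionOfSingularities.ResolutionOfSingularities.Theorems.WeightedInvariantAQSBaseChangeLexMax
import Summits.ResolutionOfSingularities.ResolutionOfSingularities.Theorems.WeightedInvariantIota3EpsStrat
import Summits.ResolutionOfSingularities.ResolutionOfSingularities.Theorems.WeightedInvariantContactLevelE2DimTwo
import Mathlib.RingTheory.Flat.Localization
import HarnessLib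

/-!
# P3c≤3 EXISTENCE, (EX-4) (L5): THE UNIFORM LEVEL BOUND AT A TIE POSITION FROM DOMINANCE, MODULO THE SEPARABILITY OF THE GENERIC
# FORMAL FIBRE OVER THE TIE CURVE (door `HypersurfaceCentreConstruction`, stmt-ResolutionOfSingularities-19897; (o70-a) step (EX-4);
# hand res-D-pv-038, plan HOME/STATUS 2026-08-27T20:54:18Z)

Topic: `Summits/ResolutionOfSingularities/ResolutionOfSingularities/Theorems`. Helper for the door item `HypersurfaceCentreConstruction`
(stmt-ResolutionOfSingularities-19897, route `WeightedInvariant`), line `local-engine` (L W4.3), def-free.  MAIN THEOREM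
`levelBound_tie_of_dominance`: at a TIE position (`Iota3.IsTiePosition S f`: `S` regular local of dimension `3`, `ε = 0`, the top
`(ν ; ε)`-stratum is the curve `P₀ = (x, y)`, a tie presentation) of a G-ring `S`, under (DOM_μ) at the triples `(q ; ta, tb)` of a ratio `a/b`
that bounds every reached ratio, AND UNDER `hcl` = the relative `p`-radical closedness of `κ(P₀ Ŝ) ⊇ κ(P₀)` (the residue field of the
generic formal fibre over the tie curve; (FF-sep), a consequence of the geometric regularity of the formal fibres of `S`, NOT proved here and
spelled out in the signature), the levels `t/q` at which two-flags carry `f` at `(q ; ta, tb)` are BOUNDED.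

PROOF.  If unbounded, `…SigmaLevelLimitFormal` gives a formal two-flag `ĥ ⊂ Ŝ` with `f ∈ 𝒥_{aν}((ĥ₁, ĥ₂); (a, b))` (weighted cylinder),
so `𝔠 = (ĥ₁, ĥ₂)` is an equimultiple formal prime, hence contains `P₀ Ŝ` ((strat) with centre `P₀`, §2, and
`map_le_of_equimultiple_adicCompletion`), hence EQUALS `P₀ Ŝ` (two-flag rigidity).  In `𝒪′ = Ŝ_𝔠 ⊇ 𝒪 = S_{P₀}` (flat, local,
`𝔪_𝒪 𝒪′ = 𝔪_{𝒪′}`, both regular of dimension `2`) the germ `(ĥ₁, ĥ₂; a, b; aν) ∋ f` competes with the tie's lex-maximal germ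
`(y, x; r, q; rν)`, ascended to `𝒪′` by res-D-pv-025's `AQSBaseChange.isLexMaxWeightedCentreGerm_map` (this is where `hcl` enters):
`a q ≤ r b`.  But the tie membership `f ∈ 𝒥_{(r+1)ν}((x, y − λx^r, z); (q, r+1, 1))` is a two-flag reaching ratio `(r+1)/q`, so
`(r+1) b ≤ a q ≤ r b` — absurd.

[OURS · L1 W4.3 · (o70-a) step (EX-4) (L5)]  Replaces the role of NO printed item; NOT a statement of the manuscript
[claim: Hironaka2017, status: under-review]. AI work, weaker than expert review.  Pure commutative algebra; the one analytic input `hcl` is a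
hypothesis spelled out in the signature (FINDING res-D-pv-038 2026-08-27T20:54:18Z, (FF-sep)).

## References

* D. Abramovich, M. H. Quek, B. Schober, arXiv:2507.01232 (v3, 2026), Thm 3.5 (base change of the lex-maximal centre). [AbramovichQuekSchober2025]
* H. Matsumura, *Commutative Ring Theory* (1987), Thm. 8.10, §32 (G-rings, formal fibres). [Matsumura1987]
* H. Hironaka, *Three key theorems on infinitely near singularities*, Sémin. Congr. 10 (2005), Rem 7.1 (2). [Hironaka2005]
-/

noncomputable section

open IsLocalRing Literature.AlgebraicGeometry.Resolution
open Summit.ResolutionOfSingularities.ResolutionOfSingularities.Theorems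
open Summit.ResolutionOfSingularities.ResolutionOfSingularities.Theorems.ContactCylinder

set_option linter.dupNamespace false -- mandated namespace of this single-conjunct summit

namespace Summit.ResolutionOfSingularities.ResolutionOfSingularities.Cruxes.HypersurfaceCentreConstruction.LocalEngine

namespace Iota3

namespace RatContact

/-! ## §1 Small tools: the tie flag, the tie membership as a two-flag filtration, images of weighted ideals -/

section Tools

variable {T : Type} [CommRing T] [IsLocalRing T]

/-- The steepened coordinate keeps the flag: `(y, x)` a two-flag, `r ≥ 1` ⇒ `(y − λ x^r, x)` a two-flag. [folklore] -/
theorem isTwoFlag_sub_mul_pow {x y : T} (h : IsTwoFlag y x) (lam : T) {r : ℕ} (hr : 1 ≤ r) : IsTwoFlag (y - lam * x ^ r) x := by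
  obtain ⟨r', rfl⟩ : ∃ r', r = r' + 1 := ⟨r - 1, by omega⟩
  refine ⟨Ideal.sub_mem _ h.1 (Ideal.mul_mem_left _ _ (Ideal.pow_mem_of_mem _ h.2.1 _ (Nat.succ_pos r'))), h.2.1,
    fun a b hab => ?_⟩
  have hab' : a * y + (b - a * lam * x ^ r') * x ∈ maximalIdeal T ^ 2 := by
    have : a * y + (b - a * lam * x ^ r') * x = a * (y - lam * x ^ (r' + 1)) + b * x := by ring
    rwa [this]
  obtain ⟨ha, hb⟩ := h.2.2 a _ hab'
  refine ⟨ha, ?_⟩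
  have : b = (b - a * lam * x ^ r') + a * lam * x ^ r' := by ring
  rw [this]
  exact Ideal.add_mem _ hb (Ideal.mul_mem_right _ _ (Ideal.mul_mem_right _ _ ha))

/-- **The tie membership is a two-flag membership**: `𝒥ₙ((x, y′, z); (q, r+1, 1)) ≤ Fil_{(y′, x)}(1 ; r+1, q)(n)` when `(x, y′, z)`
lie in `𝔪` (a monomial `x^i y′^j z^k` of weight `qi + (r+1)j + k ≥ n` is `y′^j x^i` times an element of `𝔪^k`). [folklore] -/
theorem weightedMonomialIdeal_three_le_flagContactFiltration {x y' z : T} (hz : z ∈ maximalIdeal T) (q r n : ℕ) :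
    weightedMonomialIdeal ![x, y', z] ![q, r + 1, 1] n ≤ flagContactFiltration y' x 1 (r + 1) q n := by
  unfold weightedMonomialIdeal
  rw [Ideal.span_le]
  rintro _ ⟨α, hα, rfl⟩
  rw [Fin.sum_univ_three] at hα
  simp only [Matrix.cons_val_zero, Matrix.cons_val_one, Matrix.cons_val] at hα
  rw [Fin.prod_univ_three]
  simp only [Matrix.cons_val_zero, Matrix.cons_val_one, Matrix.cons_val]
  rw [SetLike.mem_coe, flagContactFiltration_def]
  refine Ideal.mem_iSup_of_mem (α 1) (Ideal.mem_iSup_of_mem (α 0) ?_)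
  have hcomm : x ^ α 0 * y' ^ α 1 * z ^ α 2 = (y' ^ α 1 * x ^ α 0) * z ^ α 2 := by ring
  rw [hcomm]
  refine Ideal.mul_mem_mul (Ideal.mem_span_singleton_self _) (Ideal.pow_le_pow_right ?_ (Ideal.pow_mem_pow hz _))
  rw [Nat.div_one]
  omega

omit [IsLocalRing T] in
/-- `φ(𝒥ₙ((g₁, g₂); w)) = 𝒥ₙ((φ g₁, φ g₂); w)`. [folklore] -/
theorem map_weightedMonomialIdeal_pair {T' : Type} [CommRing T'] (φ : T →+* T') (g₁ g₂ : T) (w : Fin 2 → ℕ) (n : ℕ) :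
    (weightedMonomialIdeal ![g₁, g₂] w n).map φ = weightedMonomialIdeal ![φ g₁, φ g₂] w n := by
  rw [weightedMonomialIdeal, weightedMonomialIdeal, Ideal.map_span]
  have hv : (fun i => φ (![g₁, g₂] i)) = ![φ g₁, φ g₂] := by
    funext i; fin_cases i <;> rfl
  congr 1
  ext t
  constructor
  · rintro ⟨s, ⟨α, hα, rfl⟩, rfl⟩
    refine ⟨α, hα, ?_⟩
    rw [map_prod]
    exact Finset.prod_congr rfl fun i _ => by rw [map_pow, ← hv]
  · rintro ⟨α, hα, rfl⟩
    refine ⟨∏ i, ![g₁, g₂] i ^ α i, ⟨α, hα, rfl⟩, ?_⟩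
    rw [map_prod]
    exact Finset.prod_congr rfl fun i _ => by rw [map_pow, ← hv]

omit [CommRing T] [IsLocalRing T] in
/-- `Set.range ![u, v, w] = {u, v, w}`. [folklore] -/
theorem range_triple (u v w : T) : Set.range ![u, v, w] = {u, v, w} := by
  simp only [Matrix.range_cons, Matrix.range_empty, Set.union_empty, Set.singleton_union]

end Tools

/-! ## §2 (strat) for the order with centre the tie curve -/

section Strat

variable {S : Type} [CommRing S] [IsRegularLocalRing S]

/-- **At a tie position the order of `f` is kept exactly along the tie curve**: with `(x, y, z; q, r; λ)` a tie presentation and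
`ν = ord f`, for every prime `𝔭 ∋ f`: `ord_{S_𝔭} f = ν ↔ (x, y) ⊆ 𝔭` ((strat) for `iotaOrd` with centre `P₀ = (x, y)`: `ε = 0` makes the
equimultiple locus a permissible `V(P)`; `P ⊇ P₀` because `P` lies in the top `(ν ; ε)`-stratum whose prime is `P₀`; `P ⊆ P₀` because the
lex-maximal germ `(y, x; r, q; rν)` puts `f` in `P₀^ν S_{P₀}`). [OURS · (EX-4) (L5)] -/
theorem strat_iotaOrd_of_isTiePresentation {f x y z : S} {q r : ℕ} {lam : S} (hε : iotaEps S f = 0)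
    (hpres : IsTiePresentation S f x y z q r lam) (𝔭 : Ideal S) [𝔭.IsPrime] (hf𝔭 : f ∈ 𝔭) :
    iotaOrd (Localization.AtPrime 𝔭) (algebraMap S (Localization.AtPrime 𝔭) f) = iotaOrd S f ↔ Ideal.span {x, y} ≤ 𝔭 := by
  obtain ⟨-, hP₀, ν, hP, hfν, hfν1, hlex, -⟩ := hpres
  haveI := hP
  obtain ⟨hspan, hpos, -, hqr, hℓ, -, hI, -, -⟩ := hlex
  have hq : 0 < q := hpos 1
  have hqr' : q ≤ r := hqr
  have hν1 : 1 ≤ ν := by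
    rcases Nat.eq_zero_or_pos ν with h0 | h0
    · rw [h0, mul_zero] at hℓ; exact absurd hℓ (lt_irrefl 0)
    · exact h0
  have hf : f ∈ maximalIdeal S := Ideal.pow_le_self (by omega) hfν
  have hνS : iotaOrd S f = (ν : ℕ) := (iotaOrd_eq_natCast_iff S f ν).mpr ⟨hfν, hfν1⟩
  -- `ε = 0`: the permissible centre `P` and its (strat)
  have hperm : IsPermissibleEquimultipleLocus S f := (iotaEps_eq_zero_iff S f).mp hε
  obtain ⟨P, hPp, -, hfP, hiff⟩ := (isPermissibleEquimultipleLocus_iff_strat S hf).mp hperm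
  haveI := hPp
  -- (i) `P₀ ≤ P`: `P` lies in the top `(ν ; ε)`-stratum, whose prime is `P₀`
  have hordP : iotaOrd (Localization.AtPrime P) (algebraMap S (Localization.AtPrime P) f) = iotaOrd S f :=
    (hiff P hfP).mpr le_rfl
  have hεP : iotaEps (Localization.AtPrime P) (algebraMap S (Localization.AtPrime P) f) = 0 :=
    (iotaEps_eq_zero_iff _ _).mpr (isPermissibleEquimultipleLocus_localization hf hperm P hfP hordP)
  have hmem : (⟨P, hPp⟩ : PrimeSpectrum S) ∈ topStratum iotaOrdEps S f :=
    (iotaOrdEps_eq_iff _ _ _ _).mpr ⟨hordP, by rw [hεP, hε]⟩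
  have hP₀P : Ideal.span {x, y} ≤ P := by
    have h := topStratumPrime_le iotaOrdEps S f hmem
    rwa [hP₀] at h
  -- (ii) `P ≤ P₀`: the order is kept at `P₀` (the lex-maximal germ puts `f` in `𝔪^ν S_{P₀}`)
  have h𝔪O : Ideal.span {algebraMap S (Localization.AtPrime (Ideal.span ({x, y} : Set S))) y,
      algebraMap S (Localization.AtPrime (Ideal.span ({x, y} : Set S))) x} =
      maximalIdeal (Localization.AtPrime (Ideal.span ({x, y} : Set S))) := by
    have h := hspan; rw [ContactLevelE2.range_vec₂] at h; exact h
  have hfO : algebraMap S (Localization.AtPrime (Ideal.span ({x, y} : Set S))) f ∈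
      maximalIdeal (Localization.AtPrime (Ideal.span ({x, y} : Set S))) ^ ν := by
    rw [← h𝔪O]
    exact weightedMonomialIdeal_pair_le_span_pow _ _ hq hqr' ν (hI (Ideal.mem_span_singleton_self _))
  have hfP₀ : f ∈ Ideal.span ({x, y} : Set S) :=
    (IsLocalization.AtPrime.to_map_mem_maximal_iff (Localization.AtPrime (Ideal.span ({x, y} : Set S))) (Ideal.span {x, y}) f).mp
      (Ideal.pow_le_self (by omega) hfO)
  have hordP₀ : iotaOrd (Localization.AtPrime (Ideal.span ({x, y} : Set S)))
      (algebraMap S (Localization.AtPrime (Ideal.span ({x, y} : Set S))) f) = iotaOrd S f :=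
    le_antisymm (iotaOrd_generizationMonotone S (Ideal.span {x, y}) f) (hνS ▸ (natCast_le_iotaOrd_iff _ _ ν).mpr hfO)
  have hPP₀ : P ≤ Ideal.span {x, y} := (hiff (Ideal.span {x, y}) hfP₀).mp hordP₀
  rw [hiff 𝔭 hf𝔭, le_antisymm hPP₀ hP₀P]

end Strat

/-! ## §3 The generic point of the formal tie curve -/

section Formal

variable {S : Type} [CommRing S] [IsRegularLocalRing S]

/-- `dim Ŝ_{𝔠} = dim S_P` for a prime `P` of `S` whose extension `𝔠 = P Ŝ` is prime (flat going-down: `ht 𝔠 = ht P + ht(𝔠 / PŜ) = ht P`).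
[folklore] -/
theorem ringKrullDim_localization_adicCompletion_eq (P : Ideal S) [P.IsPrime] (𝔠 : Ideal (AdicCompletion (maximalIdeal S) S))
    [𝔠.IsPrime] [𝔠.LiesOver P] (h𝔠 : 𝔠 = P.map (algebraMap S (AdicCompletion (maximalIdeal S) S))) :
    ringKrullDim (Localization.AtPrime 𝔠) = ringKrullDim (Localization.AtPrime P) := by
  haveI : IsNoetherianRing (AdicCompletion (maximalIdeal S) S) := isNoetherianRing_adicCompletion_maximalIdeal S
  haveI : (P.map (algebraMap S (AdicCompletion (maximalIdeal S) S))).IsPrime := h𝔠 ▸ ‹𝔠.IsPrime›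
  rw [IsLocalization.AtPrime.ringKrullDim_eq_height 𝔠 (Localization.AtPrime 𝔠),
    IsLocalization.AtPrime.ringKrullDim_eq_height P (Localization.AtPrime P),
    Ideal.height_eq_height_add_of_liesOver_of_hasGoingDown P 𝔠]
  have h0 : 𝔠.map (Ideal.Quotient.mk (P.map (algebraMap S (AdicCompletion (maximalIdeal S) S)))) = ⊥ := by
    rw [h𝔠, Ideal.map_quotient_self]
  rw [h0, Ideal.height_bot, add_zero]

/-! ## §4 The level bound at a tie position -/

/-- **THE UNIFORM LEVEL BOUND AT A TIE POSITION FROM DOMINANCE, modulo (FF-sep).**  `S` a regular local G-ring at a TIE position for `f`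
(`IsTiePosition S f`), `ν = ord f`; a ratio `a/b` (`0 < b ≤ a`) bounding every reached ratio (`hbound`); (DOM_μ) at the triples
`(q ; ta, tb)` (`hdom`, an instance of SPEC (Δ12) rev 4 `TwoFlagDominanceAtLevelAt f`); and `hcl` = (FF-sep): for every prime `P` of `S`
with `P Ŝ` prime, the residue field extension of `S_P → Ŝ_{PŜ}` is relatively `p`-radically closed.  THEN the levels are bounded:
`∃ L, ∀` two-flag carrying `f` at `(q ; ta, tb)`, `t ≤ L q`.  Proof in the module docstring. [OURS · L1 W4.3 · (o70-a) (EX-4) (L5)]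
[cite: AbramovichQuekSchober2025, Thm 3.5] -/
theorem levelBound_tie_of_dominance (hG : IsGRing S) {f : S} (htie : IsTiePosition S f) {ν : ℕ} (hν : iotaOrd S f = (ν : ℕ))
    {a b : ℕ} (hb : 0 < b) (hba : b ≤ a)
    (hbound : ∀ q' r₁' r₂' : ℕ, AdmissibleTriple q' r₁' r₂' → FlagReaches f ν q' r₁' r₂' → r₁' * b ≤ a * r₂')
    (hdom : ∀ (g₁ g₂ g₁' g₂' : S) (q t : ℕ), 0 < q → q ≤ t * b → IsTwoFlag g₁ g₂ → IsTwoFlag g₁' g₂' →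
      f ∈ flagContactFiltration g₁ g₂ q (t * a) (t * b) (t * a * ν) →
      f ∈ flagContactFiltration g₁' g₂' q (t * a) (t * b) (t * a * ν) →
      g₁' ∈ flagContactFiltration g₁ g₂ q (t * a) (t * b) (t * a) ∧ g₂' ∈ flagContactFiltration g₁ g₂ q (t * a) (t * b) (t * b))
    (hcl : ∀ (P : Ideal S) [P.IsPrime] (𝔠 : Ideal (AdicCompletion (maximalIdeal S) S)) [𝔠.IsPrime] [𝔠.LiesOver P],
      𝔠 = P.map (algebraMap S (AdicCompletion (maximalIdeal S) S)) →
      ∀ (p : ℕ) [ExpChar (ResidueField (Localization.AtPrime 𝔠)) p],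
        letI := Localization.AtPrime.algebraOfLiesOver P 𝔠
        ∀ z : ResidueField (Localization.AtPrime 𝔠),
          z ^ p ∈ (ResidueField.map (algebraMap (Localization.AtPrime P) (Localization.AtPrime 𝔠))).range →
          z ∈ (ResidueField.map (algebraMap (Localization.AtPrime P) (Localization.AtPrime 𝔠))).range) :
    ∃ L : ℕ, ∀ (g₁ g₂ : S) (q t : ℕ), 0 < q → q ≤ t * b → IsTwoFlag g₁ g₂ →
      f ∈ flagContactFiltration g₁ g₂ q (t * a) (t * b) (t * a * ν) → t ≤ L * q := by
  classical
  by_contra hno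
  push Not at hno
  -- the tie data
  have htie' := htie
  obtain ⟨_, hdim, hε, -, x, y, z, q, r, lam, hpres⟩ := htie
  have hstrat : ∀ (𝔭 : Ideal S) [𝔭.IsPrime], f ∈ 𝔭 →
      (iotaOrd (Localization.AtPrime 𝔭) (algebraMap S (Localization.AtPrime 𝔭) f) = iotaOrd S f ↔ Ideal.span {x, y} ≤ 𝔭) :=
    fun 𝔭 _ hf𝔭 => strat_iotaOrd_of_isTiePresentation hε hpres 𝔭 hf𝔭
  obtain ⟨hxyz, hP₀, ν', hP, hfν, hfν1, hlex, htiemem⟩ := hpres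
  haveI := hP
  have hν' : ν' = ν := by
    have h := (iotaOrd_eq_natCast_iff S f ν').mpr ⟨hfν, hfν1⟩
    rw [hν] at h
    exact (Nat.cast_inj.mp h).symm
  subst hν'
  obtain ⟨hspan, hpos, -, hqr, hℓ, -, -, -, -⟩ := id hlex
  have hq : 0 < q := hpos 1
  have hr : 0 < r := hpos 0
  have hqr' : q ≤ r := hqr
  have ha : 0 < a := hb.trans_le hba
  have hν1 : 1 ≤ ν' := by
    rcases Nat.eq_zero_or_pos ν' with h0 | h0
    · rw [h0, mul_zero] at hℓ; exact absurd hℓ (lt_irrefl 0)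
    · exact h0
  -- the formal two-flag of the unbounded run and the weighted cylinder
  haveI : IsNoetherianRing (AdicCompletion (maximalIdeal S) S) := isNoetherianRing_adicCompletion_maximalIdeal S
  haveI : IsRegularLocalRing (AdicCompletion (maximalIdeal S) S) := isRegularLocalRing_adicCompletion S
  obtain ⟨ĥ₁, ĥ₂, hflĥ, hreach⟩ := exists_formal_twoFlag_of_unbounded hb hba hdom hno
  have hW : algebraMap S (AdicCompletion (maximalIdeal S) S) f ∈ weightedMonomialIdeal ![ĥ₁, ĥ₂] ![a, b] (a * ν') :=
    mem_weightedMonomialIdeal_of_forall_level fun e => by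
      obtain ⟨q₁, t₁, hq₁, -, he, hmem⟩ := hreach e
      exact ⟨q₁, t₁, hq₁, (Nat.mul_le_mul_right _ (Nat.le_add_right e 2)).trans he, hmem⟩
  -- `𝔠 = (ĥ₁, ĥ₂)` is equimultiple, hence contains `P₀ Ŝ`, hence equals it
  haveI h𝔠p : (Ideal.span ({ĥ₁, ĥ₂} : Set (AdicCompletion (maximalIdeal S) S))).IsPrime := isPrime_span_pair_of_isTwoFlag hflĥ
  have hf𝔠 : algebraMap S (AdicCompletion (maximalIdeal S) S) f ∈ Ideal.span {ĥ₁, ĥ₂} ^ ν' :=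
    weightedMonomialIdeal_pair_le_span_pow ĥ₁ ĥ₂ hb hba ν' hW
  have hle : (Ideal.span {x, y}).map (algebraMap S (AdicCompletion (maximalIdeal S) S)) ≤ Ideal.span {ĥ₁, ĥ₂} :=
    map_le_of_equimultiple_adicCompletion hG hν1 hν hstrat _ (mem_pow_maximalIdeal_localization_of_mem_pow hf𝔠)
  have h3 : (maximalIdeal S).spanFinrank = 3 := spanFinrank_eq_three_of_ringKrullDim hdim
  have hxyz' : Ideal.span (Set.range ![x, y, z]) = maximalIdeal S := by rw [range_triple]; exact hxyz
  have hflxy : IsTwoFlag x y := isTwoFlag_of_rsp h3 ![x, y, z] hxyz' (i := 0) (j := 1) (by decide)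
  have hm : (maximalIdeal S).map (algebraMap S (AdicCompletion (maximalIdeal S) S)) =
      maximalIdeal (AdicCompletion (maximalIdeal S) S) := AdicCompletion.maximalIdeal_eq_map.symm
  have h𝔠eq : Ideal.span {ĥ₁, ĥ₂} = (Ideal.span {x, y}).map (algebraMap S (AdicCompletion (maximalIdeal S) S)) := by
    rw [Iota3.map_span_pair] at hle ⊢
    exact (span_pair_eq_of_le_of_isTwoFlag (hflxy.algebraMap_of_flat hm) hflĥ hle).symm
  haveI h𝔠over : (Ideal.span ({ĥ₁, ĥ₂} : Set (AdicCompletion (maximalIdeal S) S))).LiesOver (Ideal.span {x, y}) :=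
    ⟨by rw [Ideal.under_def, h𝔠eq, Ideal.comap_map_eq_self_of_faithfullyFlat]⟩
  -- the two local rings `𝒪 = S_{P₀} → 𝒪′ = Ŝ_𝔠`
  letI := Localization.AtPrime.algebraOfLiesOver (Ideal.span ({x, y} : Set S)) (Ideal.span ({ĥ₁, ĥ₂} : Set (AdicCompletion (maximalIdeal S) S)))
  haveI : IsRegularLocalRing (Localization.AtPrime (Ideal.span ({x, y} : Set S))) := isRegularLocalRing_localization_atPrime S _
  haveI : IsRegularLocalRing (Localization.AtPrime (Ideal.span ({ĥ₁, ĥ₂} : Set (AdicCompletion (maximalIdeal S) S)))) :=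
    isRegularLocalRing_localization_atPrime _ _
  haveI : IsLocalHom (algebraMap (Localization.AtPrime (Ideal.span ({x, y} : Set S)))
      (Localization.AtPrime (Ideal.span ({ĥ₁, ĥ₂} : Set (AdicCompletion (maximalIdeal S) S))))) := by
    rw [Localization.AtPrime.IsLiesOverAlgebra.algebraMap_eq (p := Ideal.span ({x, y} : Set S))
      (P := Ideal.span ({ĥ₁, ĥ₂} : Set (AdicCompletion (maximalIdeal S) S)))]
    infer_instance
  haveI : Module.FaithfullyFlat (Localization.AtPrime (Ideal.span ({x, y} : Set S)))
      (Localization.AtPrime (Ideal.span ({ĥ₁, ĥ₂} : Set (AdicCompletion (maximalIdeal S) S)))) :=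
    Module.FaithfullyFlat.of_flat_of_isLocalHom
  have hdimO : ringKrullDim (Localization.AtPrime (Ideal.span ({x, y} : Set S))) = (2 : ℕ) := by
    haveI : (topStratumPrime iotaOrdEps S f).IsPrime := by rw [hP₀]; exact hP
    have h2 := TieFinite.IsTiePosition.ringKrullDim_localization_topStratumPrime_eq_two htie'
    rw [IsLocalization.AtPrime.ringKrullDim_eq_height (topStratumPrime iotaOrdEps S f)
      (Localization.AtPrime (topStratumPrime iotaOrdEps S f))] at h2
    rw [IsLocalization.AtPrime.ringKrullDim_eq_height (Ideal.span ({x, y} : Set S)) (Localization.AtPrime (Ideal.span ({x, y} : Set S))),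
      ← hP₀, h2]
    norm_cast
  have hdimO' : ringKrullDim (Localization.AtPrime (Ideal.span ({ĥ₁, ĥ₂} : Set (AdicCompletion (maximalIdeal S) S)))) = (2 : ℕ) := by
    rw [ringKrullDim_localization_adicCompletion_eq (Ideal.span {x, y}) _ h𝔠eq, hdimO]
  have h𝔪 : (maximalIdeal (Localization.AtPrime (Ideal.span ({x, y} : Set S)))).map
      (algebraMap (Localization.AtPrime (Ideal.span ({x, y} : Set S)))
        (Localization.AtPrime (Ideal.span ({ĥ₁, ĥ₂} : Set (AdicCompletion (maximalIdeal S) S))))) =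
      maximalIdeal (Localization.AtPrime (Ideal.span ({ĥ₁, ĥ₂} : Set (AdicCompletion (maximalIdeal S) S)))) := by
    rw [← Localization.AtPrime.map_eq_maximalIdeal, Ideal.map_map, ← IsScalarTower.algebraMap_eq,
      IsScalarTower.algebraMap_eq S (AdicCompletion (maximalIdeal S) S), ← Ideal.map_map, ← h𝔠eq,
      Localization.AtPrime.map_eq_maximalIdeal]
  -- the tie's lex-maximal germ ascends to `𝒪′`
  have hlex' := AQSBaseChange.isLexMaxWeightedCentreGerm_map hdimO hdimO' h𝔪
    (ringExpChar (ResidueField (Localization.AtPrime (Ideal.span ({ĥ₁, ĥ₂} : Set (AdicCompletion (maximalIdeal S) S))))))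
    (hcl (Ideal.span {x, y}) _ h𝔠eq _) hlex
  obtain ⟨-, -, -, -, -, -, -, hmax', -⟩ := hlex'
  -- the competitor `(ĥ₁, ĥ₂; a, b; aν)` in `𝒪′`
  have hφf : algebraMap (Localization.AtPrime (Ideal.span ({x, y} : Set S)))
        (Localization.AtPrime (Ideal.span ({ĥ₁, ĥ₂} : Set (AdicCompletion (maximalIdeal S) S))))
        (algebraMap S (Localization.AtPrime (Ideal.span ({x, y} : Set S))) f) =
      algebraMap (AdicCompletion (maximalIdeal S) S) (Localization.AtPrime (Ideal.span ({ĥ₁, ĥ₂} : Set (AdicCompletion (maximalIdeal S) S))))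
        (algebraMap S (AdicCompletion (maximalIdeal S) S) f) := by
    rw [← IsScalarTower.algebraMap_apply, ← IsScalarTower.algebraMap_apply]
  have hcomp := hmax'
    ![algebraMap (AdicCompletion (maximalIdeal S) S) (Localization.AtPrime (Ideal.span ({ĥ₁, ĥ₂} : Set (AdicCompletion (maximalIdeal S) S)))) ĥ₁,
      algebraMap (AdicCompletion (maximalIdeal S) S) (Localization.AtPrime (Ideal.span ({ĥ₁, ĥ₂} : Set (AdicCompletion (maximalIdeal S) S)))) ĥ₂]
    ![a, b] (a * ν')
    (by rw [ContactLevelE2.range_vec₂, ← Iota3.map_span_pair, Localization.AtPrime.map_eq_maximalIdeal])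
    (fun i => by fin_cases i <;> assumption) hba (Nat.mul_pos ha (by omega))
    (by
      rw [Ideal.span_singleton_le_iff_mem, hφf, ← map_weightedMonomialIdeal_pair]
      exact Ideal.mem_map_of_mem _ hW)
  have hle₁ : a * q ≤ r * b := by
    rcases hcomp with hlt | ⟨-, hle⟩
    · exact absurd hlt (not_lt.mpr (le_of_eq (by simp only [Matrix.cons_val_zero]; ring)))
    · have hle' : a * ν' * q ≤ r * ν' * b := hle
      have h' : a * q * ν' ≤ r * b * ν' := by
        calc a * q * ν' = a * ν' * q := by ring
          _ ≤ r * ν' * b := hle'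
          _ = r * b * ν' := by ring
      exact Nat.le_of_mul_le_mul_right h' (by omega)
  -- the tie flag reaches ratio `(r+1)/q`
  have hz : z ∈ maximalIdeal S := hxyz ▸ Ideal.subset_span (by simp)
  have hfl' : IsTwoFlag (y - lam * x ^ r) x := isTwoFlag_sub_mul_pow hflxy.symm lam hr
  have hreach' : FlagReaches f ν' 1 (r + 1) q :=
    ⟨y - lam * x ^ r, x, hfl', weightedMonomialIdeal_three_le_flagContactFiltration hz q r _ htiemem⟩
  have hle₂ : (r + 1) * b ≤ a * q := hbound 1 (r + 1) q ⟨one_pos, hq, by omega⟩ hreach'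
  have : r * b + b ≤ r * b := by
    calc r * b + b = (r + 1) * b := by ring
      _ ≤ a * q := hle₂
      _ ≤ r * b := hle₁
  omega

end Formal

end RatContact

end Iota3

end Summit.ResolutionOfSingularities.ResolutionOfSingularities.Cruxes.HypersurfaceCentreConstruction.LocalEngine

end
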